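import Summits.ValiantsHypothesis.ValiantsHypothesis.Theorems.BarrierLeverChowBenchmarkPairsBlockPeelConfluentRows

/-!
# Route BarrierLever — item 22038 `ChowBenchmarkPairs`, line `moore-peel`: the BLOCK PEEL, VIII-b — the CONFLUENT TRIPLE
# CRITERION: a λ-FREE integer matrix `C(i)` with `det C(i) ≠ 0 ⇒ det J^κ(i,3)(Λ) ≠ 0`, and the node «CONFLUENT B3»

Helper file (`--supports stmt-ValiantsHypothesis-22038`; cell valiant-natproofs, rung V4, 𝒟-side benchmark of record, line
`moore_peel`, planner RULING R58(c) «then attack it»; seat val-np-p4 gen 31).  Closes NO item.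

THE IDEA (memo HOME/val-np-p4/g31/memo/MEMO-valnp4-g31.md §2).  Let the three tied points of a triple block MERGE: ratios
`Λ = (1, 1+X, 1+2X)`, `X → 0`.  Row operations inside each label class `{(0,q),(1,q),(2,q)}` (second differences) and inside
the three internal pair rows make every row divisible by `X^m`, `m = 0, 1, 2`, with `X^m`-coefficients the INTEGER matrix

  `C^κ(i)`:  rows `κ̃[q,B]`, `κ̃[q,B]·B`, `κ̃[q,B]·B²` (`q < i`, `κ̃[q,B] = [T_q ⊆ T_B]·κ(|B|-|q|)`, `B` the column CODE read as
  an integer) and three pair rows `Σ_{d⊆T_B} κ|B∖d|κ|d|`, `Σ_d κ|B∖d|κ|d|·d`, `Σ_d κ|B∖d|κ|d|·(C(B-d,2) + 2(B-d)d - 3C(d,2))`,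
  columns the triple window `[c_i, c_{i+3})`

(`confMatrix`).  Hence (kernel, this file) **`det_blockMatrix_three_X_ne_zero_of_confluent`**: `det C^κ(i) ≠ 0 ⇒
det J^κ(i,3)(Λ_0,Λ_1,Λ_2) ≠ 0` in `ℤ[Λ]` — a certificate for a triple block with NO ratio parameters, and the typed node
**`Stmt.conjConfluentNearBad`** («`det C^{!}(i) ≠ 0` for every `i ≥ 1` whose triple touches a bad stage») with its arrow
**`conjB3_of_conjConfluentNearBad`** to `Stmt.conjB3`, hence to node #1 for every `h` (`segmentMeanValue_of_conjConfluentNearBad`).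
(Definitions and attached-row coefficients: the companion file `…BlockPeelConfluentRows`.)

EVIDENCE (kit j333048 / j333081 / j333183, `--workitem 22038`, ranks mod 65521): `C^{!}(i)` is nonsingular at EVERY triple
`{i,i+1,i+2}` touching a bad stage `b ≤ 3000` of THEOREM W (31 bad stages, 84 triples) — including the covering triples
`{444,445,446}`, `{726,727,728}`, `{892,893,894}`, `{1788,…}`, `{2897,…}`, `{2986,…}`, `{2997,…}` of the singular bad-start doubles and
the triples through `183, 364, 725` where the analogous confluent DOUBLE matrix `[κ̃; κ̃·B; (|B|+1)!]` is singular (deficiencies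
10, 16, 30); in the exhaustive scan `i ≤ 1000` the triple matrix is singular ONLY at the two all-good triples `i = 384, 746` (where
three good singles certify the block anyway) — hence the node below is restricted to triples touching a bad stage.  Its left null
vectors would be tuples of quadratic polynomials `P_q(B)` with `Σ_q P_q(B) κ̃[q,B]` in the span of the three pair rows on the `3i+3`
consecutive codes `[c_i, c_{i+3})`: a λ-free statement, polynomial in the code.

WHAT THIS IS NOT: `Stmt.conjConfluentB3`, `Stmt.conjB3` and node #1 stay OPEN; nothing on crux stmt-ValiantsHypothesis-14610 or
on `VP` versus `VNP`.
-/

set_option linter.dupNamespace false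

namespace Summit.ValiantsHypothesis.ValiantsHypothesis.Theorems.BarrierLever.MoorePeel

open Polynomial Finset

/-! ## 29. Coefficients of the pair rows -/

section PairCoeff

variable (κ : ℕ → ℕ) (B : ℕ)

/-- Coefficients of `pairCoef` term by term. -/
theorem coeff_pairCoef (y y' : ℤ[X]) (j : ℕ) :
    (pairCoef κ y y' B).coeff j = ∑ d ∈ (bits B).powerset,
      ((κ (bits B \ d).card : ℕ) : ℤ) * ((κ d.card : ℕ) : ℤ) * (y ^ bin (bits B \ d) * y' ^ bin d).coeff j := by
  unfold pairCoef
  rw [finsetSum_coeff]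
  refine Finset.sum_congr rfl fun d _ => ?_
  rw [show ((κ (bits B \ d).card : ℕ) : ℤ[X]) * y ^ bin (bits B \ d) * (((κ d.card : ℕ) : ℤ[X]) * y' ^ bin d) =
      C (((κ (bits B \ d).card : ℕ) : ℤ) * ((κ d.card : ℕ) : ℤ)) * (y ^ bin (bits B \ d) * y' ^ bin d) by
    rw [map_mul, map_natCast, map_natCast]; ring]
  rw [coeff_C_mul]

/-- **The symmetry `d ↔ T_B ∖ d`** of the pair weights: `Σ_d κκ·bin(B∖d) = Σ_d κκ·bin d`. -/
theorem sum_pairWeight_bin_sdiff :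
    ∑ d ∈ (bits B).powerset, ((κ (bits B \ d).card : ℕ) : ℤ) * ((κ d.card : ℕ) : ℤ) * (bin (bits B \ d) : ℤ) =
    ∑ d ∈ (bits B).powerset, ((κ (bits B \ d).card : ℕ) : ℤ) * ((κ d.card : ℕ) : ℤ) * (bin d : ℤ) := by
  refine Finset.sum_nbij' (fun d => bits B \ d) (fun d => bits B \ d) ?_ ?_ ?_ ?_ ?_
  · intro d _; exact Finset.mem_powerset.mpr Finset.sdiff_subset
  · intro d _; exact Finset.mem_powerset.mpr Finset.sdiff_subset
  · intro d hd; rw [Finset.mem_powerset] at hd; exact Finset.sdiff_sdiff_eq_self hd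
  · intro d hd; rw [Finset.mem_powerset] at hd; exact Finset.sdiff_sdiff_eq_self hd
  · intro d hd; rw [Finset.mem_powerset] at hd
    simp only [Finset.sdiff_sdiff_eq_self hd]
    ring

/-- `coeff_0 (p01) = Σ κκ`. -/
theorem coeff_pair0_zero : (pairCoef κ 1 (confPoint 1) B).coeff 0 = confPair0 κ B := by
  rw [coeff_pairCoef, confPair0]
  refine Finset.sum_congr rfl fun d _ => ?_
  rw [one_pow, one_mul, coeff_confPoint_pow_zero, mul_one]

/-- `coeff_0 (p02 - p01) = 0`. -/
theorem coeff_pair1_zero : (pairCoef κ 1 (confPoint 2) B - pairCoef κ 1 (confPoint 1) B).coeff 0 = 0 := by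
  rw [coeff_sub, coeff_pairCoef, coeff_pairCoef, ← Finset.sum_sub_distrib]
  refine Finset.sum_eq_zero fun d _ => ?_
  rw [one_pow, one_mul, one_mul, coeff_confPoint_pow_zero, coeff_confPoint_pow_zero, sub_self]

/-- `coeff_1 (p02 - p01) = Σ κκ·bin d`. -/
theorem coeff_pair1_one : (pairCoef κ 1 (confPoint 2) B - pairCoef κ 1 (confPoint 1) B).coeff 1 = confPair1 κ B := by
  rw [coeff_sub, coeff_pairCoef, coeff_pairCoef, ← Finset.sum_sub_distrib, confPair1]
  refine Finset.sum_congr rfl fun d _ => ?_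
  rw [one_pow, one_mul, one_mul, coeff_confPoint_pow_one, coeff_confPoint_pow_one]
  simp only [Fin.val_two, Fin.val_one, Nat.cast_ofNat, Nat.cast_one]
  ring

/-- The reduced pair row at position `2` with `C 2`. -/
theorem pair2_eq :
    pairCoef κ 1 (confPoint 1) B - 2 * pairCoef κ 1 (confPoint 2) B + pairCoef κ (confPoint 1) (confPoint 2) B =
    pairCoef κ 1 (confPoint 1) B - C (2 : ℤ) * pairCoef κ 1 (confPoint 2) B +
      pairCoef κ (confPoint 1) (confPoint 2) B := by
  rw [show (C (2 : ℤ) : ℤ[X]) = 2 from map_ofNat C 2]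

/-- `coeff_0 (p01 - 2 p02 + p12) = 0`. -/
theorem coeff_pair2_zero :
    (pairCoef κ 1 (confPoint 1) B - 2 * pairCoef κ 1 (confPoint 2) B + pairCoef κ (confPoint 1) (confPoint 2) B).coeff 0
      = 0 := by
  rw [pair2_eq, coeff_add, coeff_sub, coeff_C_mul, coeff_pairCoef, coeff_pairCoef, coeff_pairCoef, Finset.mul_sum,
    ← Finset.sum_sub_distrib, ← Finset.sum_add_distrib]
  refine Finset.sum_eq_zero fun d _ => ?_
  rw [one_pow, one_mul, one_mul, coeff_confPoint_pow_zero, coeff_confPoint_pow_zero, mul_coeff_zero,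
    coeff_confPoint_pow_zero, coeff_confPoint_pow_zero]
  ring

/-- `coeff_1 (p01 - 2 p02 + p12) = 0` — by the symmetry of the pair weights. -/
theorem coeff_pair2_one :
    (pairCoef κ 1 (confPoint 1) B - 2 * pairCoef κ 1 (confPoint 2) B + pairCoef κ (confPoint 1) (confPoint 2) B).coeff 1
      = 0 := by
  rw [pair2_eq, coeff_add, coeff_sub, coeff_C_mul, coeff_pairCoef, coeff_pairCoef, coeff_pairCoef, Finset.mul_sum,
    ← Finset.sum_sub_distrib, ← Finset.sum_add_distrib]
  have key : ∀ d ∈ (bits B).powerset,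
      ((κ (bits B \ d).card : ℕ) : ℤ) * ((κ d.card : ℕ) : ℤ) * ((1 : ℤ[X]) ^ bin (bits B \ d) * confPoint 1 ^ bin d).coeff 1 -
        (2 : ℤ) * (((κ (bits B \ d).card : ℕ) : ℤ) * ((κ d.card : ℕ) : ℤ) *
          ((1 : ℤ[X]) ^ bin (bits B \ d) * confPoint 2 ^ bin d).coeff 1) +
        ((κ (bits B \ d).card : ℕ) : ℤ) * ((κ d.card : ℕ) : ℤ) * (confPoint 1 ^ bin (bits B \ d) * confPoint 2 ^ bin d).coeff 1
      = ((κ (bits B \ d).card : ℕ) : ℤ) * ((κ d.card : ℕ) : ℤ) * (bin (bits B \ d) : ℤ) -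
        ((κ (bits B \ d).card : ℕ) : ℤ) * ((κ d.card : ℕ) : ℤ) * (bin d : ℤ) := by
    intro d _
    rw [one_pow, one_mul, one_mul, coeff_confPoint_pow_one, coeff_confPoint_pow_one, coeff_mul_one',
      coeff_confPoint_pow_zero, coeff_confPoint_pow_one, coeff_confPoint_pow_one, coeff_confPoint_pow_zero]
    simp only [Fin.val_two, Fin.val_one, Nat.cast_ofNat, Nat.cast_one]
    ring
  rw [Finset.sum_congr rfl key, Finset.sum_sub_distrib, sum_pairWeight_bin_sdiff, sub_self]

/-- `coeff_2 (p01 - 2 p02 + p12) = Σ κκ·(C(bin(B∖d),2) + 2·bin(B∖d)·bin d - 3·C(bin d,2))`. -/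
theorem coeff_pair2_two :
    (pairCoef κ 1 (confPoint 1) B - 2 * pairCoef κ 1 (confPoint 2) B + pairCoef κ (confPoint 1) (confPoint 2) B).coeff 2
      = confPair2 κ B := by
  rw [pair2_eq, coeff_add, coeff_sub, coeff_C_mul, coeff_pairCoef, coeff_pairCoef, coeff_pairCoef, Finset.mul_sum,
    ← Finset.sum_sub_distrib, ← Finset.sum_add_distrib, confPair2]
  refine Finset.sum_congr rfl fun d _ => ?_
  rw [one_pow, one_mul, one_mul, coeff_confPoint_pow_two, coeff_confPoint_pow_two, coeff_mul_two',
    coeff_confPoint_pow_zero, coeff_confPoint_pow_one, coeff_confPoint_pow_one, coeff_confPoint_pow_two,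
    coeff_confPoint_pow_two, coeff_confPoint_pow_zero]
  simp only [Fin.val_two, Fin.val_one, Nat.cast_ofNat, Nat.cast_one]
  ring

end PairCoeff

/-! ## 30. Division by `X` and `X²` -/

/-- A polynomial with vanishing constant term is `X · divX`. -/
theorem eq_X_mul_divX {p : ℤ[X]} (h : p.coeff 0 = 0) : p = X * divX p := by
  have e := divX_mul_X_add p
  rw [h, map_zero, add_zero, mul_comm] at e
  exact e.symm

/-- A polynomial with vanishing constant and linear terms is `X² · divX (divX ·)`. -/
theorem eq_X_sq_mul_divX_divX {p : ℤ[X]} (h0 : p.coeff 0 = 0) (h1 : p.coeff 1 = 0) :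
    p = X ^ 2 * divX (divX p) := by
  have e1 := eq_X_mul_divX h0
  have h' : (divX p).coeff 0 = 0 := by rw [coeff_divX, zero_add, h1]
  have e2 := eq_X_mul_divX h'
  rw [e2, ← mul_assoc, ← pow_two] at e1
  exact e1

/-! ## 31. Rows are `X^{pos} ·` quotient rows whose constant terms are the confluent entries -/

section Quot

variable (κ : ℕ → ℕ) (i : ℕ)

/-- `attFac2` with the literal `-2`. -/
theorem attFac2_eq (q n : ℕ) :
    (confPoint 2) ^ n + (-2 + C ((2 * q + 1 : ℕ) : ℤ) * X) * (confPoint 1) ^ n +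
      (1 - C ((2 * q + 1 : ℕ) : ℤ) * X + C ((q ^ 2 : ℕ) : ℤ) * X ^ 2) = attFac2 q n := by
  unfold attFac2
  rw [show (C (-2 : ℤ) : ℤ[X]) = -2 by simp]

/-- The quotient rows: the reduced row divided by `X^{pos}`. -/
noncomputable def confQuot (ρ : BlockIdx i 3) (B : ℕ) : ℤ[X] :=
  if confPos i ρ = 0 then confRed κ i ρ B
  else if confPos i ρ = 1 then divX (confRed κ i ρ B) else divX (divX (confRed κ i ρ B))

/-- In the third case the position is `2`. -/
theorem confPos_eq_two (ρ : BlockIdx i 3) (h0 : confPos i ρ ≠ 0) (h1 : confPos i ρ ≠ 1) : confPos i ρ = 2 := by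
  have := confPos_le_two i ρ; omega

/-- **`confRed = X^{pos} · confQuot`.** -/
theorem confRed_eq_X_pow_mul_confQuot (ρ : BlockIdx i 3) (B : ℕ) :
    confRed κ i ρ B = X ^ confPos i ρ * confQuot κ i ρ B := by
  unfold confQuot
  by_cases h0 : confPos i ρ = 0
  · rw [if_pos h0, h0, pow_zero, one_mul]
  by_cases h1 : confPos i ρ = 1
  · rw [if_neg h0, if_pos h1, h1, pow_one]
    apply eq_X_mul_divX
    by_cases hq : (ρ.2 : ℕ) < i
    · rw [confRed_att1 κ i ρ B hq h1, show (confPoint 1) ^ (B - (ρ.2 : ℕ)) - 1 + C ((ρ.2 : ℕ) : ℤ) * X =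
        attFac1 (ρ.2 : ℕ) (B - (ρ.2 : ℕ)) from rfl, coeff_natCast_mul', coeff_attFac1_zero, mul_zero]
    · rw [confRed_pair1 κ i ρ B hq h1, coeff_pair1_zero]
  · rw [if_neg h0, if_neg h1, confPos_eq_two i ρ h0 h1]
    by_cases hq : (ρ.2 : ℕ) < i
    · have e : confRed κ i ρ B = ((kincl κ (ρ.2 : ℕ) B : ℕ) : ℤ[X]) * attFac2 (ρ.2 : ℕ) (B - (ρ.2 : ℕ)) := by
        rw [confRed_att2 κ i ρ B hq h0 h1, attFac2_eq]
      apply eq_X_sq_mul_divX_divX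
      · rw [e, coeff_natCast_mul', coeff_attFac2_zero, mul_zero]
      · rw [e, coeff_natCast_mul', coeff_attFac2_one, mul_zero]
    · apply eq_X_sq_mul_divX_divX
      · rw [confRed_pair2 κ i ρ B hq h0 h1, coeff_pair2_zero]
      · rw [confRed_pair2 κ i ρ B hq h0 h1, coeff_pair2_one]

/-- `(B - q) + q = B` in `ℤ` when `T_q ⊆ T_B`, packaged with `κ̃`: `κ̃[q,B]·((B-q)+q)^m = κ̃[q,B]·B^m`. -/
theorem kincl_mul_sub_add_pow (q B m : ℕ) :
    ((kincl κ q B : ℕ) : ℤ) * ((((B - q : ℕ) : ℤ) + (q : ℤ)) ^ m) = ((kincl κ q B : ℕ) : ℤ) * (B : ℤ) ^ m := by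
  by_cases hsub : bits q ⊆ bits B
  · have hle : q ≤ B := le_of_bits_subset hsub
    rw [Nat.cast_sub hle, sub_add_cancel]
  · rw [kincl_of_not_subset κ hsub, Nat.cast_zero, zero_mul, zero_mul]

/-- **The constant terms of the quotient rows are the confluent entries.** -/
theorem coeff_zero_confQuot (ρ : BlockIdx i 3) (B : ℕ) : (confQuot κ i ρ B).coeff 0 = confEntry κ i ρ B := by
  unfold confQuot confEntry
  by_cases hq : (ρ.2 : ℕ) < i
  · rw [if_pos hq]
    have hps := confPos_of_lt i ρ hq
    rw [show (B : ℤ) ^ (ρ.1 : ℕ) = (B : ℤ) ^ confPos i ρ from by rw [hps]]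
    by_cases h0 : confPos i ρ = 0
    · rw [if_pos h0, confRed_att0 κ i ρ B hq h0, h0, pow_zero, mul_one, ← map_natCast C, coeff_C_zero]
    by_cases h1 : confPos i ρ = 1
    · rw [if_neg h0, if_pos h1, coeff_divX, zero_add, confRed_att1 κ i ρ B hq h1,
        show (confPoint 1) ^ (B - (ρ.2 : ℕ)) - 1 + C ((ρ.2 : ℕ) : ℤ) * X = attFac1 (ρ.2 : ℕ) (B - (ρ.2 : ℕ)) from rfl,
        coeff_natCast_mul', coeff_attFac1_one, h1, ← kincl_mul_sub_add_pow κ (ρ.2 : ℕ) B 1, pow_one]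
    · rw [if_neg h0, if_neg h1, coeff_divX, coeff_divX, zero_add, confRed_att2 κ i ρ B hq h0 h1, attFac2_eq,
        coeff_natCast_mul', coeff_attFac2_two, confPos_eq_two i ρ h0 h1, ← kincl_mul_sub_add_pow κ (ρ.2 : ℕ) B 2]
  · rw [if_neg hq]
    by_cases h0 : confPos i ρ = 0
    · rw [if_pos h0, if_pos h0, confRed_pair0 κ i ρ B hq h0, coeff_pair0_zero]
    by_cases h1 : confPos i ρ = 1
    · rw [if_neg h0, if_pos h1, if_neg h0, if_pos h1, coeff_divX, zero_add, confRed_pair1 κ i ρ B hq h1,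
        coeff_pair1_one]
    · rw [if_neg h0, if_neg h1, if_neg h0, if_neg h1, coeff_divX, coeff_divX, zero_add, confRed_pair2 κ i ρ B hq h0 h1,
        coeff_pair2_two]

end Quot

/-! ## 32. The factorisation `U · J(Λ_conf) = diag(X^{pos}) · Q` and the main theorem -/

section Assembly

variable (κ : ℕ → ℕ) (i : ℕ)

/-- The row-operation matrix `U` (class-wise combinations with the coefficients `confCoef`). -/
noncomputable def confU : Matrix (BlockIdx i 3) (BlockIdx i 3) ℤ[X] :=
  Matrix.of fun ρ ρ' => ∑ k : Fin 3, confCoef i ρ k * (if ρ' = confMem i k ρ then 1 else 0)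

/-- The reduced matrix `U · J(Λ_conf)` (columns read through their codes). -/
noncomputable def confRedMatrix : Matrix (BlockIdx i 3) (BlockIdx i 3) ℤ[X] :=
  Matrix.of fun ρ ρ' => confRed κ i ρ (windowStart i + (finSigmaFinEquiv ρ' : ℕ))

/-- The quotient matrix `Q` (rows divided by `X^{pos}`), columns read through their codes. -/
noncomputable def confQuotMatrix : Matrix (BlockIdx i 3) (BlockIdx i 3) ℤ[X] :=
  Matrix.of fun ρ ρ' => confQuot κ i ρ (windowStart i + (finSigmaFinEquiv ρ' : ℕ))

/-- **`U · J^κ(i,3)(Λ_conf)` is the reduced matrix.** -/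
theorem confU_mul_blockMatrix : confU i * blockMatrix κ i 3 confPoint = confRedMatrix κ i := by
  ext ρ ρ'
  have key : (confU i * blockMatrix κ i 3 confPoint) ρ ρ' =
      ∑ k : Fin 3, confCoef i ρ k * blockMatrix κ i 3 confPoint (confMem i k ρ) ρ' := by
    rw [Matrix.mul_apply]
    simp only [confU, Matrix.of_apply, Finset.sum_mul, mul_assoc, ite_mul, one_mul, zero_mul]
    rw [Finset.sum_comm]
    refine Finset.sum_congr rfl fun k _ => ?_
    rw [← Finset.mul_sum, Finset.sum_ite_eq' Finset.univ (confMem i k ρ), if_pos (Finset.mem_univ _)]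
  rw [key]
  rfl

/-- **The reduced matrix is `diag(X^{pos}) ·` the quotient matrix.** -/
theorem confRedMatrix_eq : confRedMatrix κ i = Matrix.diagonal (fun ρ => (X : ℤ[X]) ^ confPos i ρ) * confQuotMatrix κ i := by
  ext ρ ρ'
  rw [Matrix.diagonal_mul, confRedMatrix, confQuotMatrix, Matrix.of_apply, Matrix.of_apply,
    confRed_eq_X_pow_mul_confQuot]

/-- **The constant-term matrix of the quotient matrix is the confluent matrix.** -/
theorem confQuotMatrix_map_constantCoeff :
    (Polynomial.constantCoeff : ℤ[X] →+* ℤ).mapMatrix (confQuotMatrix κ i) = confMatrix κ i := by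
  ext ρ ρ'
  rw [RingHom.mapMatrix_apply, Matrix.map_apply, confQuotMatrix, confMatrix, Matrix.of_apply, Matrix.of_apply,
    Polynomial.constantCoeff_apply, coeff_zero_confQuot]

/-- **THE CONFLUENT CRITERION (point form).**  `det C^κ(i) ≠ 0 ⇒ det J^κ(i,3)(1, 1+X, 1+2X) ≠ 0` in `ℤ[X]`. -/
theorem det_blockMatrix_confPoint_ne_zero (hC : (confMatrix κ i).det ≠ 0) :
    (blockMatrix κ i 3 confPoint).det ≠ 0 := by
  intro hJ
  have h1 : (confU i * blockMatrix κ i 3 confPoint).det = 0 := by rw [Matrix.det_mul, hJ, mul_zero]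
  rw [confU_mul_blockMatrix, confRedMatrix_eq, Matrix.det_mul, Matrix.det_diagonal] at h1
  rcases mul_eq_zero.mp h1 with h | h
  · exact absurd h (Finset.prod_ne_zero_iff.mpr fun ρ _ => pow_ne_zero _ X_ne_zero)
  · apply hC
    have e := RingHom.map_det (Polynomial.constantCoeff : ℤ[X] →+* ℤ) (confQuotMatrix κ i)
    rw [h, map_zero, confQuotMatrix_map_constantCoeff] at e
    exact e.symm

/-- **THE CONFLUENT CRITERION (symbolic form).**  `det C^κ(i) ≠ 0 ⇒ det J^κ(i,3)(Λ_0,Λ_1,Λ_2) ≠ 0` in `ℤ[Λ]` — a λ-free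
integer certificate for the triple block. -/
theorem det_blockMatrix_three_X_ne_zero_of_confluent (hC : (confMatrix κ i).det ≠ 0) :
    (blockMatrix κ i 3 (fun s : Fin 3 => (MvPolynomial.X s : MvPolynomial (Fin 3) ℤ))).det ≠ 0 :=
  det_blockMatrix_X_ne_zero_of_point κ i 3 confPoint (det_blockMatrix_confPoint_ne_zero κ i hC)

end Assembly

/-! ## 33. The node «CONFLUENT B3 AT THE BAD STAGES» and its arrow -/

/-- **CONJECTURE «CONFLUENT B3 NEAR THE BAD STAGES»** (memo g31 §2, typed): for every stage `i ≥ 1` such that the triple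
`{i, i+1, i+2}` contains a bad stage of THEOREM W (`det G_j = 0`), the λ-free integer confluent matrix `C^{!}(i)`
(`confMatrix Nat.factorial i`) is nonsingular.  EVIDENCE: every such triple with a bad stage `≤ 3000` (kit j333048, j333183) and
the exhaustive scan `i ≤ 1000` (kit j333081), where `C^{!}(i)` is singular ONLY at the all-good triples `i = 384, 746` — hence the
restriction to triples touching a bad stage (at all-good triples three singles certify the block, `conjB3_iff_near_bad`).
REFUTER TARGET: one triple touching a bad stage with `C^{!}(i)` singular mod two primes (kills this node, not B3). -/
def Stmt.conjConfluentNearBad : Prop :=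
  ∀ i : ℕ, 1 ≤ i → ((peelMatrix i).det = 0 ∨ (peelMatrix (i + 1)).det = 0 ∨ (peelMatrix (i + 2)).det = 0) →
    (confMatrix Nat.factorial i).det ≠ 0

/-- **THE ARROW `CONFLUENT NEAR BAD ⇒ B3`** (through `conjB3_iff_near_bad` of `…BlockPeelConcat` and the confluent criterion). -/
theorem conjB3_of_conjConfluentNearBad (h : Stmt.conjConfluentNearBad) : Stmt.conjB3 :=
  conjB3_iff_near_bad.mpr fun i hi hbad => det_blockMatrix_three_X_ne_zero_of_confluent Nat.factorial i (h i hi hbad)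

/-- Hence «cover triple» of `…BlockPeelCoverTriple`. -/
theorem conjCoverTriple_of_conjConfluentNearBad (h : Stmt.conjConfluentNearBad) : Stmt.conjCoverTriple :=
  conjCoverTriple_of_conjB3 (conjB3_of_conjConfluentNearBad h)

/-- Hence «bad ends» of `…BlockPeelCoverTriple`. -/
theorem conjBadEnds_of_conjConfluentNearBad (h : Stmt.conjConfluentNearBad) : Stmt.conjBadEnds :=
  conjBadEnds_of_conjB3 (conjB3_of_conjConfluentNearBad h)

/-- **THE ARROW TO NODE #1, verbatim**: under «confluent B3 near the bad stages» the line file's `SegmentMeanValueAt h`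
holds for EVERY `h` (the registered node #1 `stub_segmentMeanValue`). -/
theorem segmentMeanValue_of_conjConfluentNearBad (h : Stmt.conjConfluentNearBad) (hh : ℕ) :
    ∀ (r : ℕ) (u : Fin r → Finset (Fin hh)), Function.Injective u → (∀ i, (u i).card ≤ 2) →
      (∀ S : Finset (Fin hh), S.card ≤ 2 → ∃ i, u i = S) →
      ∃ P : Fin hh → Fin hh → ℂ,
        (Matrix.of fun i j : Fin r =>
          ∑ g : (↥(benchCols hh r j) → ↥(u i)), (∏ c : ↥(benchCols hh r j), P (g c) c) *
            ∏ a : ↥(u i),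
              ((Finset.univ.filter fun c : ↥(benchCols hh r j) => g c = a).card.factorial : ℂ)).det ≠ 0 :=
  segmentMeanValue_of_conjB3 (conjB3_of_conjConfluentNearBad h) hh

end Summit.ValiantsHypothesis.ValiantsHypothesis.Theorems.BarrierLever.MoorePeel
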